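import Mathlib.NumberTheory.Multiplicity
import Mathlib.Data.ZMod.Units
import Mathlib.RingTheory.ZMod.UnitsCyclic
import Literature.NumberTheory.GaloisRepresentations.DirichletCharacterOfGaloisCharacter
import Summits.BirchSwinnertonDyer.Rank1Residual.GaloisImage.CyclotomicLevelFrobenius
import Summits.BirchSwinnertonDyer.Rank1Residual.GaloisImage.NonsplitMultiplicativeUnramifiedPrelims
import HarnessLib

/-!
# The `p`-layer generated by Frobenius at a Kolyvagin prime (the `cores_p`-direction transversal)
# — file CK-1 of row T-DER-CK (THEOREM C's kernel inputs; cell `b2b-bsdres`, team n1011,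
# seat p15 GEN 7; skel `cells/n1011/skel/T-DER-CK.md`)

HONEST FRAMING (cell `b2b-bsdres`, run/shared/lean/b2b/bsd-rank1-residual/, verbatim in every
file): the goal of the cell is to DELETE the COMBINATION-SHAPED residual classes of the
Birch–Swinnerton-Dyer formula for ALL analytic-rank `≤ 1` elliptic curves over `ℚ` — "full BSD
formula for every rank `≤ 1` curve in class `C`" assembled STRICTLY from published theorems — so
that the rank-`≤ 1` remainder becomes exactly the CONSTRUCTION-SHAPED classes, which are TYPED
(missing-input `Prop`s), NOT attempted. This is not "finishing BSD". Team n1011: research route on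
the CONSTRUCTION-SHAPED class X4 / §I N11 (route-1 PORT, (P-DER)); TOOL theorems of Galois theory
only (`p`-free except "`p` odd" where lifting-the-exponent needs it; curve-free); 0 defs, 0 named
facts, 0 `sorry`; nothing is booked; no mark / label / flag text moves; census −0.

## What (referee-1 GEN 35, THEOREM C proviso (iv): "the `q`-inert-in-`F_{n+k}/F_n` layer
## arithmetic is a separate lemma with its own statement")

THEOREM C of row T-DER (the finite–singular relation of Kolyvagin's derivative classes) needs the
CONGRUENCE, which Perrin-Riou (*Systèmes d'Euler p-adiques et théorie d'Iwasawa*, Ann. Inst.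
Fourier 48 (1998), Prop. 2.2.5 (ii)) derives from the norm relations by ASCENDING THE `p`-TOWER at
the prime `λ ∣ q`: one works in the layer `F_{r+n}(rq)/F_r(rq)` of degree `M = pⁿ` in which `λ` is
INERT, its decomposition group being generated by (a lift of) `Frob_q^f`.  The tree's ascent lemmas
(file C0b `KolyvaginCongruenceAscent`, p11 GEN 8) are stated for abstract subgroups `V₁ ≤ V₀`, an
element `φ ∈ V₀` with `φ^M ∈ V₁` and the SECTION `i ↦ φ^i` (`i < M`) of `V₀/V₁` (through which
F2 `resLe_coresLe_eq_sum` turns `res ∘ Cor` into `Σ_{i<M} φ^i·`).  This file supplies that datum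
for the cyclotomic levels `L = cyclotomicLevelsRat p S` over `ℚ` (`F_k(r) = ℚ(μ_{p^k} μ_r)`):
* §1 `Rat.exists_isArithFrobAtPlace_mem_rootsOfUnityFixer` — at every finite place `q` (prime
  `q′`) there is an arithmetic Frobenius `φ` FIXING `μ_{q′}` (any Frobenius times an absolute
  inertia element with the inverse mod-`q′` cyclotomic character, tree
  `exists_mem_inertia_modNCyclotomicCharacter_eq`), so `φ ∈ L.tameLevel q` ("`Frob·inertia`");
* §2 `Rat.pow_mem_rootsOfUnityFixer_iff_of_isArithFrobAtPlace` — `φ^f ∈ Gal(ℚ̄/ℚ(μ_m))` iff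
  `q′^f ≡ 1 (mod m)` (`q′ ∤ m`) (the level compatibility `χ_d = χ_m mod d` used by the sequel is the
  tree's `unitsMap_modNCyclotomicCharacter`, file `DirichletCharacterOfGaloisCharacter`);
* §3 `prime_pow_dvd_pow_sub_one_iff` — lifting the exponent (Mathlib `padicValNat.pow_sub_pow`,
  `p` odd): for `x > 1` with `p ∣ x − 1` and `r = v_p(x − 1)`, `p^{r+n} ∣ x^m − 1 ↔ pⁿ ∣ m`;
* §4 small helpers (`Rat.cyclotomicLevelsRat_pLevel`, …) and §5
  `Rat.exists_generator_rootsOfUnityFixer_prime_pow` — a `γ ∈ Γ_ℚ` with `χ_{p^r}(γ)` GENERATING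
  `(ℤ/p^r)ˣ` (`p` odd: Mathlib `ZMod.isCyclic_units_of_prime_pow`) and fixing every root of unity
  of order prime to `p`, hence lying in every `L.level ⊥ t` of usable places
  (`Rat.mem_level_bot_of_forall_coprime_mem_rootsOfUnityFixer`), with the TRANSVERSAL
  `Rat.existsUnique_lt_generator_pow_inv_mul_mem_level`: every `g ∈ L.level ⊥ t` is `γ^j · u`,
  `j < #(ℤ/p^r)ˣ = p^{r−1}(p−1)` unique, `u ∈ L.level r t` — the representatives `γ^j` of the
  DESCENT `Cor_{F_r(t)/F_0(t)}` (file C0c `exists_sub_eq_sub_one_apply_of_descent`), packaged in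
  ROW T-DER's `hcov`/`hinj` coset shapes as `Rat.exists_generator_level_bot` (bound
  `(p − 1)·p^{r−1}`, one `γ` for all `t`).
The LEVEL CURRENCY of the ascent (`φ^f ∈ V₀ = L.level r t`, `(φ^f)^m ∈ L.pLevel (r+n) ↔ pⁿ ∣ m`,
and the transversal of `V₀/V₁`, `V₁ = L.level (r+n) t`, by the powers of `φ^f`) is the sequel
file `CyclotomicLevelPTowerTransversal`.
NOT CLAIMED: `p = 2` (LTE fails: `v₂(3² − 1) = 3`); base fields other than `ℚ`.

References (context; nothing cited as an input): B. Perrin-Riou, Ann. Inst. Fourier 48 (1998),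
proof of Prop. 2.2.5 (ii), p. 1252; K. Rubin, *Euler Systems* (2000), §4.4; K. Rubin, in LNM 1716
(1999), Prop. 8.6 ("since the decomposition group of `𝔮` in `K_∞/K` is infinite").
-/

noncomputable section

open Field IsDedekindDomain
open scoped NumberField

namespace Summit.BirchSwinnertonDyer.Rank1Residual.GaloisImage.CyclotomicLevel

open Literature.NumberTheory.GaloisRepresentations

/-! ### §1 A Frobenius at `q` fixing `μ_q` -/

namespace Rat

open Rat.HeightOneSpectrum

/-- **An arithmetic Frobenius at `q` fixing `μ_{q′}`** (`q′` the prime of the place `q` of `ℚ`):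
there is `φ ∈ Γ_ℚ` which is an arithmetic Frobenius at `q` (`IsArithFrobAtPlace`) AND lies in
`Gal(ℚ̄/ℚ(μ_{q′}))`.  Any Frobenius `Fr` at `𝔔 ∣ q` times the absolute inertia element
`τ ∈ I_𝔔` with `χ_{q′}(τ) = χ_{q′}(Fr)⁻¹` (tree `exists_mem_inertia_modNCyclotomicCharacter_eq`:
`χ_{q′}(I_𝔔) = (ℤ/q′)ˣ`, `ℚ(μ_{q′})` being totally ramified at `q′`) will do (a Frobenius
times an inertia element is a Frobenius: tree `NonsplitKummer.isArithFrobAt_mul_of_mem_inertia`).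
This is the "`Frob^f · inertia`" of Perrin-Riou's ascent: a Frobenius of the level `ℚ(μ_{rq′})`
itself. [folklore] -/
theorem exists_isArithFrobAtPlace_mem_rootsOfUnityFixer (v : HeightOneSpectrum (𝓞 ℚ)) :
    ∃ φ : absoluteGaloisGroup ℚ, IsArithFrobAtPlace ℚ v φ ∧
      φ ∈ rootsOfUnityFixer ℚ ((primesEquiv v : Nat.Primes) : ℕ) := by
  set ℓ : ℕ := ((primesEquiv v : Nat.Primes) : ℕ) with hℓdef
  have hℓ : ℓ.Prime := (primesEquiv v).2
  haveI : Fact ℓ.Prime := ⟨hℓ⟩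
  haveI : NeZero ℓ := ⟨hℓ.ne_zero⟩
  obtain ⟨𝔓, h𝔓⟩ := v.primesAbove_nonempty
  haveI := h𝔓.1
  obtain ⟨Fr, hFr⟩ := HeightOneSpectrum.exists_isArithFrobAt_of_mem_primesAbove_holds h𝔓
  -- an absolute inertia element with `χ_ℓ = χ_ℓ(Fr)⁻¹`
  have hm : ℓ = ℓ ^ (0 + 1) * 1 := by rw [zero_add, pow_one, mul_one]
  have hd : ¬ ℓ ∣ 1 := hℓ.not_dvd_one
  have ha : ZMod.unitsMap (Dvd.intro_left _ hm.symm) (modNCyclotomicCharacter ℚ ℓ Fr)⁻¹ = 1 :=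
    Subsingleton.elim _ _
  obtain ⟨τ, hτI, hτχ⟩ := exists_mem_inertia_modNCyclotomicCharacter_eq (v := v) hm hd rfl h𝔓 ha
  refine ⟨Fr * τ, ⟨𝔓, h𝔓, NonsplitKummer.isArithFrobAt_mul_of_mem_inertia hFr hτI⟩, ?_⟩
  rw [rootsOfUnityFixer_eq_ker, MonoidHom.mem_ker, map_mul, hτχ, mul_inv_cancel]

/-- The same in the currency of `cyclotomicLevelsRat p S`: an arithmetic Frobenius at `q` inside
the tame level `L.tameLevel q = Gal(ℚ̄/ℚ(μ_{q′}))`. [folklore] -/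
theorem exists_isArithFrobAtPlace_mem_tameLevel (p : ℕ) [Fact p.Prime]
    (S : Set (HeightOneSpectrum (𝓞 ℚ))) (q : HeightOneSpectrum (𝓞 ℚ)) :
    ∃ φ : absoluteGaloisGroup ℚ, IsArithFrobAtPlace ℚ q φ ∧ φ ∈ (cyclotomicLevelsRat p S).tameLevel q := by
  rw [cyclotomicLevelsRat_tameLevel]
  exact exists_isArithFrobAtPlace_mem_rootsOfUnityFixer q

/-! ### §2 Powers of a Frobenius and roots of unity -/

/-- `χ_n(φ^f) = q′^f` for an arithmetic Frobenius `φ` at `q`, `q′ ∤ n`. [folklore] -/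
theorem modNCyclotomicCharacter_pow_of_isArithFrobAtPlace {n : ℕ} [NeZero n]
    {v : HeightOneSpectrum (𝓞 ℚ)} (hn : ¬ ((primesEquiv v : Nat.Primes) : ℕ) ∣ n)
    {φ : absoluteGaloisGroup ℚ} (hφ : IsArithFrobAtPlace ℚ v φ) (f : ℕ) :
    ((modNCyclotomicCharacter ℚ n (φ ^ f) : (ZMod n)ˣ) : ZMod n) =
      ((((primesEquiv v : Nat.Primes) : ℕ) ^ f : ℕ) : ZMod n) := by
  rw [map_pow, Units.val_pow_eq_pow_val, modNCyclotomicCharacter_of_isArithFrobAtPlace hn hφ,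
    Nat.cast_pow]

/-- **`φ^f` fixes `μ_n` iff `q′^f ≡ 1 (mod n)`** (`φ` an arithmetic Frobenius at the place `q` of
`ℚ` with prime `q′ ∤ n`). [folklore] -/
theorem pow_mem_rootsOfUnityFixer_iff_of_isArithFrobAtPlace {n : ℕ} [NeZero n]
    {v : HeightOneSpectrum (𝓞 ℚ)} (hn : ¬ ((primesEquiv v : Nat.Primes) : ℕ) ∣ n)
    {φ : absoluteGaloisGroup ℚ} (hφ : IsArithFrobAtPlace ℚ v φ) (f : ℕ) :
    φ ^ f ∈ rootsOfUnityFixer ℚ n ↔ ((primesEquiv v : Nat.Primes) : ℕ) ^ f ≡ 1 [MOD n] := by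
  rw [rootsOfUnityFixer_eq_ker, MonoidHom.mem_ker, ← ZMod.natCast_eq_natCast_iff, Nat.cast_one,
    ← modNCyclotomicCharacter_pow_of_isArithFrobAtPlace hn hφ f, Units.val_eq_one]

end Rat

/-! ### §3 Lifting the exponent: the `p`-adic order of `x^m − 1` -/

section LTE

variable {p : ℕ} [hp : Fact p.Prime]

/-- **`v_p(x^m − 1) = v_p(x − 1) + v_p(m)`** for an odd prime `p`, `x > 1` with `p ∣ x − 1` and
`m ≠ 0` (Mathlib's lifting-the-exponent lemma `padicValNat.pow_sub_pow` at `y = 1`). [folklore] -/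
theorem padicValNat_pow_sub_one (hp2 : p ≠ 2) {x : ℕ} (hx : 1 < x) (hpx : p ∣ x - 1) {m : ℕ}
    (hm : m ≠ 0) : padicValNat p (x ^ m - 1) = padicValNat p (x - 1) + padicValNat p m := by
  have hodd : Odd p := hp.out.odd_of_ne_two hp2
  have hnot : ¬ p ∣ x := fun h => hp.out.not_dvd_one (by
    have e : 1 = x - (x - 1) := by omega
    rw [e]; exact Nat.dvd_sub h hpx)
  have h := padicValNat.pow_sub_pow hodd hx hpx hnot hm
  rwa [one_pow] at h

/-- **`p^{r+n} ∣ x^m − 1 ↔ pⁿ ∣ m`** for an odd prime `p`, `x > 1` with `p ∣ x − 1` and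
`r = v_p(x − 1)` (all `m`; for `m = 0` both sides hold).  For `x = q′^f` this says that `q′^f` has
order EXACTLY `pⁿ` in `(ℤ/p^{r+n})ˣ`, i.e. the primes of `ℚ(μ_{p^r} μ_t)` above `q′` (residue degree
`f`) are INERT in `ℚ(μ_{p^{r+n}} μ_t)`.  False for `p = 2` (`v₂(3² − 1) = 3`). [folklore] -/
theorem prime_pow_dvd_pow_sub_one_iff (hp2 : p ≠ 2) {x : ℕ} (hx : 1 < x) (hpx : p ∣ x - 1)
    {r : ℕ} (hr : padicValNat p (x - 1) = r) (n m : ℕ) :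
    p ^ (r + n) ∣ x ^ m - 1 ↔ p ^ n ∣ m := by
  rcases eq_or_ne m 0 with rfl | hm
  · simp
  have hxm : x ^ m - 1 ≠ 0 := Nat.sub_ne_zero_of_lt (Nat.one_lt_pow hm hx)
  rw [padicValNat_dvd_iff_le hxm, padicValNat_pow_sub_one hp2 hx hpx hm, hr,
    padicValNat_dvd_iff_le hm]
  omega

end LTE

/-! ### §4 Small helpers in the currency of `cyclotomicLevelsRat p S` -/

namespace Rat

open Rat.HeightOneSpectrum

variable (p : ℕ) [hp : Fact p.Prime] (S : Set (HeightOneSpectrum (𝓞 ℚ)))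

/-- The `p`-levels of `cyclotomicLevelsRat p S` (definitional unfolding, for rewriting):
`pLevel k = Gal(ℚ̄/ℚ(μ_{p^k}))`. [folklore] -/
theorem cyclotomicLevelsRat_pLevel (k : ℕ) :
    (cyclotomicLevelsRat p S).pLevel k = rootsOfUnityFixer ℚ (p ^ k) :=
  rfl

variable {p S}

/-- `q′ ∤ p^k` for a usable place `q` of `cyclotomicLevelsRat p S` (`q′ ≠ p`). [folklore] -/
theorem not_dvd_prime_pow_of_mem_primes {q : HeightOneSpectrum (𝓞 ℚ)}
    (hq : q ∈ (cyclotomicLevelsRat p S).primes) (k : ℕ) :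
    ¬ ((primesEquiv q : Nat.Primes) : ℕ) ∣ p ^ k := fun h =>
  ((mem_cyclotomicLevelsRat_primes_iff p S q).mp hq).2
    ((Nat.prime_dvd_prime_iff_eq (primesEquiv q).2 hp.out).mp ((primesEquiv q).2.dvd_of_dvd_pow h))

/-- `1 < q′^f` for `f ≠ 0`. [folklore] -/
theorem one_lt_primesEquiv_pow (q : HeightOneSpectrum (𝓞 ℚ)) {f : ℕ} (hf : f ≠ 0) :
    1 < ((primesEquiv q : Nat.Primes) : ℕ) ^ f :=
  Nat.one_lt_pow hf (primesEquiv q).2.one_lt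

omit hp in
/-- `q′^f ≡ 1 (mod p^r)` for `r = v_p(q′^f − 1)` (`p^{v_p(x)} ∣ x`). [folklore] -/
theorem primesEquiv_pow_modEq_one_of_padicValNat_eq (q : HeightOneSpectrum (𝓞 ℚ)) {f r : ℕ}
    (hr : padicValNat p (((primesEquiv q : Nat.Primes) : ℕ) ^ f - 1) = r) :
    ((primesEquiv q : Nat.Primes) : ℕ) ^ f ≡ 1 [MOD p ^ r] := by
  rw [Nat.ModEq.comm, Nat.modEq_iff_dvd' (Nat.one_le_iff_ne_zero.mpr
    (pow_ne_zero f (primesEquiv q).2.ne_zero)), ← hr]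
  exact pow_padicValNat_dvd

/-! ### §5 A generator `γ` of the `p`-direction over the tame levels (the section of
`level ⊥ t / level r t ≃ (ℤ/p^r)ˣ` used by the descent, file C0c) -/

/-- **A generator of `Gal(ℚ(μ_{p^r})/ℚ)` fixing all roots of unity of order prime to `p`**
(`p` odd, so `(ℤ/p^r)ˣ` is cyclic — Mathlib `ZMod.isCyclic_units_of_prime_pow`): there is
`γ ∈ Γ_ℚ` with `χ_{p^r}(γ)` generating `(ℤ/p^r)ˣ` and `γ ∈ Gal(ℚ̄/ℚ(μ_m))` for every `m` prime to
`p` (tree `RootOfUnityAction.exists_smul_eq_pow_and_smul_eq_self` /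
`exists_smul_eq_smul_and_smul_eq_self`, irreducibility of cyclotomic polynomials over `ℚ`) — the
`p`-direction twin of T-DER-INST's `exists_sigma`. [folklore] -/
theorem exists_generator_rootsOfUnityFixer_prime_pow (hp2 : p ≠ 2) (r : ℕ) :
    haveI : NeZero (p ^ r) := ⟨pow_ne_zero _ hp.out.ne_zero⟩
    ∃ γ : absoluteGaloisGroup ℚ,
      (∀ x : (ZMod (p ^ r))ˣ, x ∈ Subgroup.zpowers (modNCyclotomicCharacter ℚ (p ^ r) γ)) ∧
      ∀ m : ℕ, p.Coprime m → γ ∈ rootsOfUnityFixer ℚ m := by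
  haveI : NeZero (p ^ r) := ⟨pow_ne_zero _ hp.out.ne_zero⟩
  haveI : IsCyclic (ZMod (p ^ r))ˣ := ZMod.isCyclic_units_of_prime_pow p hp.out hp2 r
  obtain ⟨g, hg⟩ := IsCyclic.exists_generator (α := (ZMod (p ^ r))ˣ)
  have hirr : Irreducible (Polynomial.cyclotomic (p ^ r * 1) ℚ) := by
    rw [mul_one]
    exact Polynomial.cyclotomic.irreducible_rat (pow_pos hp.out.pos r)
  obtain ⟨τ, hτ, -⟩ := RootOfUnityAction.exists_smul_eq_pow_and_smul_eq_self (K := ℚ)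
    (Nat.coprime_one_right (p ^ r)) hirr g
  obtain ⟨γ, hγp, hγm⟩ := RootOfUnityAction.exists_smul_eq_smul_and_smul_eq_self (K := ℚ)
    (fun n hn ↦ Polynomial.cyclotomic.irreducible_rat hn) hp.out τ
  obtain ⟨ζ, hζ⟩ := HasEnoughRootsOfUnity.exists_primitiveRoot (AlgebraicClosure ℚ) (p ^ r)
  have hχ : modNCyclotomicCharacter ℚ (p ^ r) γ = g := by
    apply Units.ext
    have h1 : γ • ζ = ζ ^ (g : ZMod (p ^ r)).val := by
      rw [hγp r ζ hζ.pow_eq_one, hτ ζ hζ.pow_eq_one]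
    rw [modNCyclotomicCharacter_eq_of_smul_eq_pow ℚ (p ^ r) hζ γ h1, ZMod.natCast_zmod_val]
  refine ⟨γ, fun x ↦ hχ ▸ hg x, fun m hm ↦ ?_⟩
  rw [mem_rootsOfUnityFixer_iff]
  exact hγm m hm

/-- Such a `γ` lies in every level `L.level ⊥ t` of `cyclotomicLevelsRat p S` built from USABLE
places (`ℓ′ ≠ p`): `level ⊥ t = ⨅_{ℓ ∈ t} Gal(ℚ̄/ℚ(μ_{ℓ′}))`. [folklore] -/
theorem mem_level_bot_of_forall_coprime_mem_rootsOfUnityFixer {γ : absoluteGaloisGroup ℚ}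
    (hγ : ∀ m : ℕ, p.Coprime m → γ ∈ rootsOfUnityFixer ℚ m)
    (t : Finset (HeightOneSpectrum (𝓞 ℚ))) (ht : ∀ ℓ ∈ t, ℓ ∈ (cyclotomicLevelsRat p S).primes) :
    γ ∈ (cyclotomicLevelsRat p S).level ⊥ t := by
  refine (cyclotomicLevelsRat p S).mem_level_iff.mpr ⟨?_, fun ℓ hℓ ↦ ?_⟩
  · rw [(cyclotomicLevelsRat p S).pLevel_bot]
    exact Subgroup.mem_top γ
  · rw [cyclotomicLevelsRat_tameLevel]
    exact hγ _ (((Nat.coprime_primes hp.out (primesEquiv ℓ).2).mpr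
      ((mem_cyclotomicLevelsRat_primes_iff p S ℓ).mp (ht ℓ hℓ)).2.symm))

/-- **TRANSVERSAL of the `p`-levels over the tame level** (`hcov₀`/`hinj₀` for the descent C0c):
if `χ_{p^r}(γ)` generates `(ℤ/p^r)ˣ`, every `g ∈ L.level ⊥ t` is `γ^j · u` with a UNIQUE
`j < #(ℤ/p^r)ˣ` and `u ∈ L.level r t` (`Gal(F_r(t)/F_0(t)) ≃ (ℤ/p^r)ˣ = ⟨γ⟩`; T-DER-INST's
`existsUnique_pow_inv_mul_mem_rootsOfUnityFixer` at the modulus `p^r`, plus the tame bookkeeping).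
[folklore] -/
theorem existsUnique_lt_generator_pow_inv_mul_mem_level {r : ℕ} {γ : absoluteGaloisGroup ℚ}
    (hgen : haveI : NeZero (p ^ r) := ⟨pow_ne_zero _ hp.out.ne_zero⟩
      ∀ x : (ZMod (p ^ r))ˣ, x ∈ Subgroup.zpowers (modNCyclotomicCharacter ℚ (p ^ r) γ))
    {t : Finset (HeightOneSpectrum (𝓞 ℚ))} (hγt : γ ∈ (cyclotomicLevelsRat p S).level ⊥ t)
    {g : absoluteGaloisGroup ℚ} (hg : g ∈ (cyclotomicLevelsRat p S).level ⊥ t) :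
    haveI : NeZero (p ^ r) := ⟨pow_ne_zero _ hp.out.ne_zero⟩
    ∃! j : ℕ, j < Nat.card (ZMod (p ^ r))ˣ ∧ (γ ^ j)⁻¹ * g ∈ (cyclotomicLevelsRat p S).level r t := by
  haveI : NeZero (p ^ r) := ⟨pow_ne_zero _ hp.out.ne_zero⟩
  obtain ⟨j, ⟨hj, hjg⟩, huniq⟩ := existsUnique_pow_inv_mul_mem_rootsOfUnityFixer γ hgen g
  have htame : ∀ i : ℕ, ∀ ℓ ∈ t, (γ ^ i)⁻¹ * g ∈ (cyclotomicLevelsRat p S).tameLevel ℓ :=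
    fun i ℓ hℓ ↦ Subgroup.mul_mem _ (Subgroup.inv_mem _ (Subgroup.pow_mem _
      (((cyclotomicLevelsRat p S).mem_level_iff.mp hγt).2 ℓ hℓ) i))
      (((cyclotomicLevelsRat p S).mem_level_iff.mp hg).2 ℓ hℓ)
  refine ⟨j, ⟨hj, (cyclotomicLevelsRat p S).mem_level_iff.mpr ⟨hjg, htame j⟩⟩, fun j' ⟨hj', hj'g⟩ ↦
    huniq j' ⟨hj', ((cyclotomicLevelsRat p S).mem_level_iff.mp hj'g).1⟩⟩

/-- `#(ℤ/p^r)ˣ = p^{r−1}(p − 1)` for `r ≥ 1` (the degree `[F_r(t) : F_0(t)]`). [folklore] -/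
theorem natCard_units_zmod_prime_pow {r : ℕ} (hr : 0 < r) :
    haveI : NeZero (p ^ r) := ⟨pow_ne_zero _ hp.out.ne_zero⟩
    Nat.card (ZMod (p ^ r))ˣ = p ^ (r - 1) * (p - 1) := by
  haveI : NeZero (p ^ r) := ⟨pow_ne_zero _ hp.out.ne_zero⟩
  rw [Nat.card_eq_fintype_card, ZMod.card_units_eq_totient, Nat.totient_prime_pow hp.out hr]


variable (S) in
/-- **(d4) The `γ^j`-transversal of the `p`-DESCENT layer `F_r(t)/F_0(t)`, in ROW T-DER's coset
shapes** (`p` odd, `r ≥ 1`): ONE `γ ∈ Γ_ℚ` lying in every bottom level `L.level ⊥ t` of usable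
places (`(⊥ : ℕ) = 0`) such that, for every such `t`, every `g ∈ L.level ⊥ t` is `γ^j · u` with
`j < (p − 1)·p^{r−1} = [ℚ(μ_{p^r}) : ℚ]` and `u ∈ L.level r t` (`hcov₀`), the exponent being unique
(`hinj₀`) — the representatives `γ^j` of `U_0/U_r` in C0c `exists_sub_eq_sub_one_apply_of_descent`,
for `t = r` and `t = rq` at once. [folklore] -/
theorem exists_generator_level_bot (hp2 : p ≠ 2) {r : ℕ} (hr : 0 < r) :
    ∃ γ : absoluteGaloisGroup ℚ,
      (∀ t : Finset (HeightOneSpectrum (𝓞 ℚ)), (∀ ℓ ∈ t, ℓ ∈ (cyclotomicLevelsRat p S).primes) →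
        γ ∈ (cyclotomicLevelsRat p S).level ⊥ t) ∧
      ∀ t : Finset (HeightOneSpectrum (𝓞 ℚ)), (∀ ℓ ∈ t, ℓ ∈ (cyclotomicLevelsRat p S).primes) →
        (∀ g ∈ (cyclotomicLevelsRat p S).level ⊥ t,
          ∃ j < (p - 1) * p ^ (r - 1), (γ ^ j)⁻¹ * g ∈ (cyclotomicLevelsRat p S).level r t) ∧
        ∀ j₁ < (p - 1) * p ^ (r - 1), ∀ j₂ < (p - 1) * p ^ (r - 1),
          (γ ^ j₁)⁻¹ * γ ^ j₂ ∈ (cyclotomicLevelsRat p S).level r t → j₁ = j₂ := by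
  haveI : NeZero (p ^ r) := ⟨pow_ne_zero _ hp.out.ne_zero⟩
  obtain ⟨γ, hgen, hγm⟩ := exists_generator_rootsOfUnityFixer_prime_pow (p := p) hp2 r
  have hN : Nat.card (ZMod (p ^ r))ˣ = (p - 1) * p ^ (r - 1) := by
    rw [natCard_units_zmod_prime_pow hr, mul_comm]
  refine ⟨γ, fun t ht ↦ mem_level_bot_of_forall_coprime_mem_rootsOfUnityFixer hγm t ht,
    fun t ht ↦ ⟨fun g hg ↦ ?_, fun j₁ hj₁ j₂ hj₂ h ↦ ?_⟩⟩
  · obtain ⟨j, ⟨hj, hjg⟩, -⟩ := existsUnique_lt_generator_pow_inv_mul_mem_level hgen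
      (mem_level_bot_of_forall_coprime_mem_rootsOfUnityFixer hγm t ht) hg
    exact ⟨j, hN ▸ hj, hjg⟩
  · rw [← hN] at hj₁ hj₂
    have h₁ : (γ ^ j₁)⁻¹ * γ ^ j₂ ∈ rootsOfUnityFixer ℚ (p ^ r) :=
      ((cyclotomicLevelsRat p S).mem_level_iff.mp h).1
    have h₂ : (γ ^ j₂)⁻¹ * γ ^ j₂ ∈ rootsOfUnityFixer ℚ (p ^ r) := by
      rw [inv_mul_cancel]
      exact one_mem _
    exact (existsUnique_pow_inv_mul_mem_rootsOfUnityFixer γ hgen (γ ^ j₂)).unique ⟨hj₁, h₁⟩ ⟨hj₂, h₂⟩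

end Rat

end Summit.BirchSwinnertonDyer.Rank1Residual.GaloisImage.CyclotomicLevel

end
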